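import Summits.ResolutionOfSingularities.ResolutionOfSingularities.Theorems.EquisingularLiftEquisingularLiftNatPointStepTransport
import Literature.AlgebraicGeometry.Resolution.NormalCrossingsLocal
import Literature.AlgebraicGeometry.Resolution.BlowupSequences
import Literature.AlgebraicGeometry.Resolution.MonomialOrderReductionUnit
import HarnessLib

/-!
# [OURS] REGULARITY OF THE BLOW-UP AT A POINT IS LOCAL ON THE BASE; THE DOWNSTAIRS CHAIN «blow up the one-step singular points one at a time»
# (cruxes `Theses.EquisingularLift.EquisingularLiftNat` / `…NatThree`, stmt-ResolutionOfSingularities-20038 / -20148)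

[OURS · leafhand-res-equisingularlift-10 g0, 2026-08-31; cell `pub/decomp-res`] AI-produced, weaker than expert review; NOT a statement of any manuscript; nothing
here proves resolution of singularities.  DEF-FREE; no `sorry`; standard axioms; ZERO named hypotheses.  The brick named as missing in ✓ `…NatIsoHypPointOfPointBlowup`
(p829027) for the MULTI-POINT, ARBITRARY-POSITION bridge «one-step singular points ⟹ the lead's hypothesis #7 `IsoHypPoint` (= `PointResolvable`)».  A point `y`
of `Γ` is ONE-STEP (spelled inline, no definition) if every blow-up of `Γ` at the reduced closed point `y` is regular at its points over `y`.  Namespace `PointChain`: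
* ★★ `oneStepAt_of_isIso_morphismRestrict` — LOCALITY: `ρ : Γ₂ → Γ` an isomorphism over an open `U ∋ y`, `y₂` over `y`: `y` one-step ⟹ `y₂` one-step (both
  blow-ups restrict over `ρ⁻¹U ≅ U` to blow-ups of `U` at its point over `y` — ✓ `IsBlowup.restrict`, ✓ `isBlowup_comp_iso_vanishingIdeal_singleton` — unique up to
  isomorphism, ✓ `IsBlowup.unique`); tools `comap_vanishingIdeal_singleton_openι`, `eq_of_isIso_morphismRestrict`, `exists_preimage_of_isIso_morphismRestrict`,
  `isClosed_singleton_of_injective`, `oneStepAt_of_iso`;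
* ★★★ `chain_of_oneStepPoints` — THE DOWNSTAIRS INDUCTION in the ambient chain of `PtResolvable`/`IsoHypPoint` (step = blow-up of the ambient at a non-regular closed
  point of the reduced strict transform; next strict transform `closure υ⁻¹(T ∖ {x})`): a stage `(F, ρ_F, T)` (`F` locally Noetherian, `T` closed irreducible) whose
  reduced strict transform `Γ = V(T)_red` is regular exactly off a finite set `S` of closed one-step points, with a point `ξ ∈ T` off `S`, reaches in `|S|` steps a stage
  with REGULAR reduced strict transform, uniformly in the chain predicate `Q`.  Step: blow up `x ∈ S`; the new reduced strict transform is a blow-up of `Γ` at `x`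
  (✓ `exists_isBlowup_reducedStrictTransform_point`, Stacks 080E), integral (✓ `IsBlowup.isIntegral`), regular over `x`, isomorphic to `Γ` off `x`
  (✓ `IsBlowup.isIso_morphismRestrict`, ✓ `IsBlowup.isIso_stalkMap_of_not_mem_support`); the other points of `S` stay closed, non-regular, one-step (locality).
Honest label: closes no registered stub.  References: [StacksProject, Tags 080E, 02OS]; [GortzWedhorn2020, Prop. 13.91, (13.19)]; [Liu2002, §8.1] — via the tree files.
-/

set_option linter.dupNamespace false

noncomputable section

open CategoryTheory CategoryTheory.Limits AlgebraicGeometry TopologicalSpace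
open Literature.AlgebraicGeometry.Resolution
open AlgebraicGeometry.Scheme.IdealSheafData

namespace Summit.ResolutionOfSingularities.ResolutionOfSingularities.Cruxes.EquisingularLiftNat.Sections

namespace PointChain

universe u

/-- A point of an open subscheme lying over a closed point is closed. [folklore] -/
theorem isClosed_singleton_of_openι_eq {X : Scheme.{u}} (U : X.Opens) {y : X} (hy : IsClosed ({y} : Set X))
    (u₀ : (U : Scheme.{u})) (hu₀ : U.ι u₀ = y) : IsClosed ({u₀} : Set (U : Scheme.{u})) := by
  have e : ({u₀} : Set (U : Scheme.{u})) = U.ι ⁻¹' {y} := by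
    ext v
    simp only [Set.mem_singleton_iff, Set.mem_preimage]
    exact ⟨fun h => by rw [h, hu₀], fun h => U.ι.isOpenEmbedding.injective (h.trans hu₀.symm)⟩
  rw [e]; exact hy.preimage U.ι.continuous

/-- Comap of the reduced closed point `y` along the inclusion of an open `U ∋ y` is the reduced point of `U` over `y`. [folklore] -/
theorem comap_vanishingIdeal_singleton_openι {X : Scheme.{u}} (U : X.Opens) {y : X} (hy : IsClosed ({y} : Set X))
    (u₀ : (U : Scheme.{u})) (hu₀ : U.ι u₀ = y) (hu₀cl : IsClosed ({u₀} : Set (U : Scheme.{u}))) :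
    (vanishingIdeal (⟨{y}, hy⟩ : Closeds X)).comap U.ι = vanishingIdeal (⟨{u₀}, hu₀cl⟩ : Closeds (U : Scheme.{u})) := by
  rw [comap_vanishingIdeal_of_isOpenImmersion]
  congr 1
  apply Closeds.ext
  ext v
  change U.ι v ∈ ({y} : Set X) ↔ v ∈ ({u₀} : Set (U : Scheme.{u}))
  simp only [Set.mem_singleton_iff]
  exact ⟨fun h => U.ι.isOpenEmbedding.injective (h.trans hu₀.symm), fun h => by rw [h, hu₀]⟩

/-- **REGULARITY OF THE BLOW-UP AT A POINT IS LOCAL ON THE BASE.**  Let `ρ : Γ₂ → Γ` be a morphism which restricts to an isomorphism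
over an open `U ∋ y` (`y` a closed point), and `y₂ ∈ Γ₂` a closed point over `y`.  If every blow-up of `Γ` at the reduced point `y`
is regular at its points over `y`, then every blow-up of `Γ₂` at the reduced point `y₂` is regular at its points over `y₂`: both
restrict over `ρ⁻¹U ≅ U` to blow-ups of `U` at its point over `y`, which are unique up to isomorphism. [folklore]
[cite: GortzWedhorn2020, (13.19)] -/
theorem oneStepAt_of_isIso_morphismRestrict {Γ Γ₂ : Scheme.{u}} (ρ : Γ₂ ⟶ Γ) (U : Γ.Opens) [IsIso (ρ ∣_ U)]
    {y : Γ} (hyU : y ∈ U) (hy : IsClosed ({y} : Set Γ))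
    (hone : ∀ (B : Scheme.{u}) (π : B ⟶ Γ), IsBlowup π (vanishingIdeal ⟨{y}, hy⟩) →
      ∀ b : B, π b = y → IsRegularLocalRing (B.presheaf.stalk b))
    {y₂ : Γ₂} (hy₂ : ρ y₂ = y) (hy₂cl : IsClosed ({y₂} : Set Γ₂)) :
    ∀ (Z : Scheme.{u}) (τ : Z ⟶ Γ₂), IsBlowup τ (vanishingIdeal ⟨{y₂}, hy₂cl⟩) →
      ∀ z : Z, τ z = y₂ → IsRegularLocalRing (Z.presheaf.stalk z) := by
  intro Z τ hτ z hz
  -- the open `V = ρ⁻¹ U ∋ y₂` and the isomorphism `e : V ≅ U`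
  set V : Γ₂.Opens := ρ ⁻¹ᵁ U with hV
  have hy₂V : y₂ ∈ V := by change ρ y₂ ∈ U; rw [hy₂]; exact hyU
  let e : (V : Scheme.{u}) ≅ (U : Scheme.{u}) := asIso (ρ ∣_ U)
  obtain ⟨u₀, hu₀⟩ : ∃ u₀ : (U : Scheme.{u}), U.ι u₀ = y := ⟨⟨y, hyU⟩, rfl⟩
  obtain ⟨v₀, hv₀⟩ : ∃ v₀ : (V : Scheme.{u}), V.ι v₀ = y₂ := ⟨⟨y₂, hy₂V⟩, rfl⟩
  have hu₀cl := isClosed_singleton_of_openι_eq U hy u₀ hu₀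
  have hv₀cl := isClosed_singleton_of_openι_eq V hy₂cl v₀ hv₀
  have hev : e.hom v₀ = u₀ := by
    apply U.ι.isOpenEmbedding.injective
    rw [hu₀, ← Scheme.Hom.comp_apply]
    change ((ρ ∣_ U) ≫ U.ι) v₀ = y; rw [morphismRestrict_ι, Scheme.Hom.comp_apply, hv₀, hy₂]
  -- `τ` restricted over `V`, then moved to `U`: a blow-up of `U` at `u₀`
  have hτV : IsBlowup (τ ∣_ V) (vanishingIdeal ⟨{v₀}, hv₀cl⟩) := by
    have h := hτ.restrict V
    rwa [comap_vanishingIdeal_singleton_openι V hy₂cl v₀ hv₀ hv₀cl] at h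
  have hey : IsClosed ({e.hom v₀} : Set (U : Scheme.{u})) := by rw [hev]; exact hu₀cl
  have hτU : IsBlowup (τ ∣_ V ≫ e.hom) (vanishingIdeal ⟨{e.hom v₀}, hey⟩) :=
    isBlowup_comp_iso_vanishingIdeal_singleton hv₀cl hτV e hey
  have hC : (⟨{e.hom v₀}, hey⟩ : Closeds (U : Scheme.{u})) = ⟨{u₀}, hu₀cl⟩ := Closeds.ext (by
    change ({e.hom v₀} : Set (U : Scheme.{u})) = {u₀}
    rw [hev])
  rw [hC] at hτU
  -- the reference blow-up `B → Γ` at `y`, restricted over `U`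
  obtain ⟨B, πB, hπB⟩ : ∃ (B : Scheme.{u}) (πB : B ⟶ Γ), IsBlowup πB (vanishingIdeal ⟨{y}, hy⟩) :=
    ⟨_, _, blowup.isBlowup (vanishingIdeal (⟨{y}, hy⟩ : Closeds Γ))⟩
  have hπBU : IsBlowup (πB ∣_ U) (vanishingIdeal ⟨{u₀}, hu₀cl⟩) := by
    have h := hπB.restrict U
    rwa [comap_vanishingIdeal_singleton_openι U hy u₀ hu₀ hu₀cl] at h
  -- uniqueness of blow-ups: `τ⁻¹ V ≅ πB⁻¹ U` over `U`
  obtain ⟨e₂, he₂, -⟩ := hτU.unique hπBU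
  -- the point `z` inside `τ⁻¹ V`, and its image `b` in `B`
  have hzV : z ∈ τ ⁻¹ᵁ V := by change τ z ∈ V; rw [hz]; exact hy₂V
  obtain ⟨zV, hzV'⟩ : ∃ zV : (τ ⁻¹ᵁ V : Scheme.{u}), (τ ⁻¹ᵁ V).ι zV = z := ⟨⟨z, hzV⟩, rfl⟩
  have hτzV : (τ ∣_ V) zV = v₀ := by
    apply V.ι.isOpenEmbedding.injective
    rw [hv₀, ← Scheme.Hom.comp_apply, morphismRestrict_ι, Scheme.Hom.comp_apply, hzV', hz]
  set b : B := (πB ⁻¹ᵁ U).ι (e₂.hom zV) with hbdef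
  have hb : πB b = y := by
    rw [hbdef, ← Scheme.Hom.comp_apply, ← morphismRestrict_ι, Scheme.Hom.comp_apply, ← Scheme.Hom.comp_apply e₂.hom, he₂,
      Scheme.Hom.comp_apply, hτzV, hev, hu₀]
  -- regularity transported along the stalk isomorphisms
  haveI hBreg : IsRegularLocalRing (B.presheaf.stalk b) := hone B πB hπB b hb
  haveI : IsRegularLocalRing ((πB ⁻¹ᵁ U : Scheme.{u}).presheaf.stalk (e₂.hom zV)) :=
    IsRegularLocalRing.of_ringEquiv (R := B.presheaf.stalk b) (asIso (((πB ⁻¹ᵁ U).ι).stalkMap (e₂.hom zV))).commRingCatIsoToRingEquiv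
  haveI : IsRegularLocalRing ((τ ⁻¹ᵁ V : Scheme.{u}).presheaf.stalk zV) :=
    IsRegularLocalRing.of_ringEquiv (R := (πB ⁻¹ᵁ U : Scheme.{u}).presheaf.stalk (e₂.hom zV))
      (asIso (e₂.hom.stalkMap zV)).commRingCatIsoToRingEquiv
  rw [← hzV']
  exact IsRegularLocalRing.of_ringEquiv (R := (τ ⁻¹ᵁ V : Scheme.{u}).presheaf.stalk zV)
    (asIso (((τ ⁻¹ᵁ V).ι).stalkMap zV)).commRingCatIsoToRingEquiv.symm


/-! ## Small tools -/

/-- A morphism which restricts to an isomorphism over an open `U` is injective over `U`. [folklore] -/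
theorem eq_of_isIso_morphismRestrict {X Y : Scheme.{u}} (f : X ⟶ Y) (U : Y.Opens) [IsIso (f ∣_ U)] {a b : X}
    (ha : f a ∈ U) (hab : f a = f b) : a = b := by
  obtain ⟨aU, haU⟩ : ∃ aU : (f ⁻¹ᵁ U : Scheme.{u}), (f ⁻¹ᵁ U).ι aU = a := ⟨⟨a, ha⟩, rfl⟩
  obtain ⟨bU, hbU⟩ : ∃ bU : (f ⁻¹ᵁ U : Scheme.{u}), (f ⁻¹ᵁ U).ι bU = b := ⟨⟨b, show f b ∈ U by rw [← hab]; exact ha⟩, rfl⟩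
  have h : (f ∣_ U) aU = (f ∣_ U) bU := by
    apply U.ι.isOpenEmbedding.injective
    rw [← Scheme.Hom.comp_apply, ← Scheme.Hom.comp_apply, morphismRestrict_ι, Scheme.Hom.comp_apply, Scheme.Hom.comp_apply,
      haU, hbU, hab]
  rw [← haU, ← hbU, (Scheme.homeoOfIso (asIso (f ∣_ U))).injective h]

/-- Over an open `U` where `f` restricts to an isomorphism, every point of `U` has a preimage. [folklore] -/
theorem exists_preimage_of_isIso_morphismRestrict {X Y : Scheme.{u}} (f : X ⟶ Y) (U : Y.Opens) [IsIso (f ∣_ U)] {y : Y}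
    (hy : y ∈ U) : ∃ a : X, f a = y := by
  obtain ⟨u, hu⟩ : ∃ u : (U : Scheme.{u}), U.ι u = y := ⟨⟨y, hy⟩, rfl⟩
  refine ⟨(f ⁻¹ᵁ U).ι ((inv (f ∣_ U)) u), ?_⟩
  rw [← Scheme.Hom.comp_apply, ← morphismRestrict_ι, Scheme.Hom.comp_apply, ← Scheme.Hom.comp_apply (inv (f ∣_ U)),
    IsIso.inv_hom_id]
  exact hu

/-- A point of a closed subscheme whose image is a closed point is a closed point. [folklore] -/
theorem isClosed_singleton_of_injective {X Y : Scheme.{u}} (f : X ⟶ Y) (hf : Function.Injective f) {x : X}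
    (hx : IsClosed ({f x} : Set Y)) : IsClosed ({x} : Set X) := by
  have e : ({x} : Set X) = f ⁻¹' {f x} := by
    ext z; simp only [Set.mem_singleton_iff, Set.mem_preimage]; exact ⟨fun h => by rw [h], fun h => hf h⟩
  rw [e]; exact hx.preimage f.continuous

/-- **`OneStepAt` transports along an isomorphism.** [folklore] -/
theorem oneStepAt_of_iso {Γ Γ' : Scheme.{u}} (e : Γ ≅ Γ') {y : Γ} (hy : IsClosed ({y} : Set Γ))
    (hone : ∀ (B : Scheme.{u}) (π : B ⟶ Γ), IsBlowup π (vanishingIdeal ⟨{y}, hy⟩) →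
      ∀ b : B, π b = y → IsRegularLocalRing (B.presheaf.stalk b))
    (hy' : IsClosed ({e.hom y} : Set Γ')) :
    ∀ (Z : Scheme.{u}) (τ : Z ⟶ Γ'), IsBlowup τ (vanishingIdeal ⟨{e.hom y}, hy'⟩) →
      ∀ z : Z, τ z = e.hom y → IsRegularLocalRing (Z.presheaf.stalk z) := by
  intro Z τ hτ z hz
  have hyy : e.symm.hom (e.hom y) = y := by change (e.hom ≫ e.inv) y = y; rw [e.hom_inv_id]; rfl
  have hy'' : IsClosed ({e.symm.hom (e.hom y)} : Set Γ) := by rw [hyy]; exact hy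
  have h := isBlowup_comp_iso_vanishingIdeal_singleton hy' hτ e.symm hy''
  have hC : (⟨{e.symm.hom (e.hom y)}, hy''⟩ : Closeds Γ) = ⟨{y}, hy⟩ := Closeds.ext (by
    change ({e.symm.hom (e.hom y)} : Set Γ) = {y}
    rw [hyy])
  rw [hC] at h
  refine hone Z (τ ≫ e.symm.hom) h z ?_
  rw [Scheme.Hom.comp_apply, hz, hyy]

/-! ## The downstairs chain: blow up the one-step singular points one at a time -/

/-- **THE DOWNSTAIRS INDUCTION.**  In the ambient chain of `PtResolvable`/`IsoHypPoint` (steps = blow-ups of the ambient at a non-regular closed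
point of the reduced strict transform), a stage `(F, ρ_F, T)` — `T` closed irreducible, `F` locally Noetherian — whose reduced strict transform
`Γ = V(T)_red` has exactly the non-regular points `S` (a finite set of closed points), each a ONE-STEP point in the abstract sense «every blow-up of
`Γ` at the reduced point is regular over it», and a point `ξ ∈ T` off `S`, reaches in `|S|` steps a stage with REGULAR reduced strict transform.
Induction on `|S|`: blow up one `x ∈ S`; the reduced strict transform is a blow-up of `Γ` at `x` (✓ `exists_isBlowup_reducedStrictTransform_point`,
Stacks 080E), regular over `x`, isomorphic to `Γ` elsewhere, and the remaining points stay one-step (`oneStepAt_of_isIso_morphismRestrict`).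
[OURS] [cite: StacksProject, Tag 080E] -/
theorem chain_of_oneStepPoints {P : Scheme.{0}} :
    ∀ (N : ℕ) (F : Scheme.{0}) [IsLocallyNoetherian F] (ρF : F ⟶ P) (T : Set F) (_ : IsClosed T) (_ : IsIrreducible T)
      (C : Closeds F) (_ : (⟨closure T, isClosed_closure⟩ : Closeds F) = C)
      (S : Finset ↥(vanishingIdeal C).subscheme) (_ : S.card = N)
      (ξ : F) (_ : ξ ∈ (C : Set F)) (_ : ∀ x ∈ S, ((vanishingIdeal C).subschemeι x : F) ≠ ξ)
      (_ : ∀ x : ↥(vanishingIdeal C).subscheme, x ∉ S → IsRegularLocalRing ((vanishingIdeal C).subscheme.presheaf.stalk x))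
      (_ : ∀ x ∈ S, IsClosed ({((vanishingIdeal C).subschemeι x : F)} : Set F))
      (_ : ∀ x ∈ S, ¬ IsRegularLocalRing ((vanishingIdeal C).subscheme.presheaf.stalk x))
      (_ : ∀ x ∈ S, ∀ (hx : IsClosed ({x} : Set ↥(vanishingIdeal C).subscheme)) (Z : Scheme.{0}) (τ : Z ⟶ (vanishingIdeal C).subscheme),
        IsBlowup τ (vanishingIdeal ⟨{x}, hx⟩) → ∀ z : Z, τ z = x → IsRegularLocalRing (Z.presheaf.stalk z)),
      ∃ (F' : Scheme.{0}) (ρ' : F' ⟶ P) (T' : Set F'),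
        (∀ Q : (∀ F₁ : Scheme.{0}, (F₁ ⟶ P) → Set F₁ → Prop),
          (∀ (F₁ F₂ : Scheme.{0}) (ρ : F₁ ⟶ P) (T₁ : Set F₁)
            (x : ↥(vanishingIdeal (⟨closure T₁, isClosed_closure⟩ : Closeds F₁)).subscheme) (υ : F₂ ⟶ F₁)
            (hx : IsClosed ({((vanishingIdeal (⟨closure T₁, isClosed_closure⟩ : Closeds F₁)).subschemeι x : F₁)} : Set F₁)),
            Q F₁ ρ T₁ → ¬ IsRegularLocalRing ((vanishingIdeal (⟨closure T₁, isClosed_closure⟩ : Closeds F₁)).subscheme.presheaf.stalk x) →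
            IsBlowup υ (vanishingIdeal (⟨{((vanishingIdeal (⟨closure T₁, isClosed_closure⟩ : Closeds F₁)).subschemeι x : F₁)}, hx⟩ :
              Closeds F₁)) →
            Q F₂ (υ ≫ ρ) (closure (υ ⁻¹' (T₁ \ {((vanishingIdeal (⟨closure T₁, isClosed_closure⟩ : Closeds F₁)).subschemeι x : F₁)})))) →
          Q F ρF T → Q F' ρ' T') ∧
        Scheme.IsRegular (vanishingIdeal (⟨closure T', isClosed_closure⟩ : Closeds F')).subscheme := by
  intro N
  induction N with
  | zero =>
    intro F _ ρF T hT hTirr C hTC S hS ξ hξC hξS hreg hcl hsing hone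
    subst hTC
    refine ⟨F, ρF, T, fun Q _ hQ => hQ, fun x => hreg x ?_⟩
    rw [Finset.card_eq_zero] at hS; rw [hS]; exact Finset.notMem_empty x
  | succ N ih =>
    intro F _ ρF T hT hTirr C hTC S hS ξ hξC hξS hreg hcl hsing hone
    subst hTC
    classical
    -- notation
    have hclT : closure T = T := hT.closure_eq
    -- pick a point to blow up
    obtain ⟨x, hxS⟩ : S.Nonempty := Finset.card_pos.mp (by omega)
    have hx := hcl x hxS
    have hxsing := hsing x hxS
    have hne : ¬ (closure T ⊆ {((vanishingIdeal (⟨closure T, isClosed_closure⟩ : Closeds F)).subschemeι x : F)}) :=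
      fun h => hξS x hxS (Set.mem_singleton_iff.mp (h hξC)).symm
    -- the ambient blow-up at `ι x`
    obtain ⟨𝔫, h𝔫⟩ : ∃ 𝔫 : F.IdealSheafData,
        𝔫 = vanishingIdeal (⟨{((vanishingIdeal (⟨closure T, isClosed_closure⟩ : Closeds F)).subschemeι x : F)}, hx⟩ : Closeds F) := ⟨_, rfl⟩
    have h𝔫supp : (𝔫.support : Set F) = {((vanishingIdeal (⟨closure T, isClosed_closure⟩ : Closeds F)).subschemeι x : F)} := by
      rw [h𝔫, Scheme.IdealSheafData.coe_support_vanishingIdeal]; rfl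
    have hυ : IsBlowup (blowup.π 𝔫) 𝔫 := blowup.isBlowup 𝔫
    haveI : IsProper (blowup.π 𝔫) := hυ.isProper
    haveI : IsLocallyNoetherian (blowup 𝔫) := LocallyOfFiniteType.isLocallyNoetherian (blowup.π 𝔫)
    have hυ' : IsBlowup (blowup.π 𝔫)
        (vanishingIdeal (⟨{((vanishingIdeal (⟨closure T, isClosed_closure⟩ : Closeds F)).subschemeι x : F)}, hx⟩ : Closeds F)) := by
      rw [← h𝔫]; exact hυ
    -- the reduced strict transform is a blow-up of `Γ` at `x`
    obtain ⟨hxcl, ρ, hρι, -, hρbl⟩ := exists_isBlowup_reducedStrictTransform_point F (blowup 𝔫) (closure T) isClosed_closure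
      hTirr.closure x hx hne (blowup.π 𝔫) hυ'
    generalize hC₂ : (⟨closure ((blowup.π 𝔫) ⁻¹' (closure T \ ((vanishingIdeal (⟨{((vanishingIdeal (⟨closure T, isClosed_closure⟩ :
        Closeds F)).subschemeι x : F)}, hx⟩ : Closeds F)).support : Set F))), isClosed_closure⟩ : Closeds (blowup 𝔫)) = C₂ at ρ hρι hρbl
    -- shorthand facts
    have hsuppx : ((vanishingIdeal (⟨{((vanishingIdeal (⟨closure T, isClosed_closure⟩ : Closeds F)).subschemeι x : F)}, hx⟩ :
        Closeds F)).support : Set F) = {((vanishingIdeal (⟨closure T, isClosed_closure⟩ : Closeds F)).subschemeι x : F)} :=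
      Scheme.IdealSheafData.coe_support_vanishingIdeal _
    have hιinj : Function.Injective (vanishingIdeal (⟨closure T, isClosed_closure⟩ : Closeds F)).subschemeι :=
      (vanishingIdeal (⟨closure T, isClosed_closure⟩ : Closeds F)).subschemeι.isClosedEmbedding.injective
    have hι₂inj : Function.Injective (vanishingIdeal C₂).subschemeι := (vanishingIdeal C₂).subschemeι.isClosedEmbedding.injective
    have hρι_apply : ∀ z : ↥(vanishingIdeal C₂).subscheme,
        (vanishingIdeal (⟨closure T, isClosed_closure⟩ : Closeds F)).subschemeι (ρ z) = (blowup.π 𝔫) ((vanishingIdeal C₂).subschemeι z) :=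
      fun z => by rw [← Scheme.Hom.comp_apply, hρι, Scheme.Hom.comp_apply]
    have hC₂set : (C₂ : Set (blowup 𝔫)) = closure ((blowup.π 𝔫) ⁻¹' (T \ {((vanishingIdeal (⟨closure T, isClosed_closure⟩ :
        Closeds F)).subschemeι x : F)})) := by
      rw [← hC₂]
      change closure ((blowup.π 𝔫) ⁻¹' (closure T \ _)) = closure _
      rw [hsuppx]
      have hmemclT : ∀ w, w ∈ closure T ↔ w ∈ T := fun w => by rw [hclT]
      have hAB : closure T \ {((vanishingIdeal (⟨closure T, isClosed_closure⟩ : Closeds F)).subschemeι x : F)} =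
          T \ {((vanishingIdeal (⟨closure T, isClosed_closure⟩ : Closeds F)).subschemeι x : F)} := by
        rw [Set.ext_iff]; intro w; simp only [Set.mem_sdiff, hmemclT]
      rw [hAB]
    -- integrality of `Γ` and of the blown-up `Γ₂`
    haveI hΓint : IsIntegral (vanishingIdeal (⟨closure T, isClosed_closure⟩ : Closeds F)).subscheme :=
      isIntegral_subscheme_vanishingIdeal _ hTirr.closure
    obtain ⟨ξ', hξ'⟩ : ∃ ξ' : ↥(vanishingIdeal (⟨closure T, isClosed_closure⟩ : Closeds F)).subscheme,
        (vanishingIdeal (⟨closure T, isClosed_closure⟩ : Closeds F)).subschemeι ξ' = ξ := by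
      have h : ξ ∈ Set.range (vanishingIdeal (⟨closure T, isClosed_closure⟩ : Closeds F)).subschemeι := by
        rw [Scheme.IdealSheafData.range_subschemeι, Scheme.IdealSheafData.coe_support_vanishingIdeal]; exact hξC
      exact h
    have hξ'x : ξ' ≠ x := fun h => hξS x hxS (by rw [← hξ', h])
    have h𝔪ne : vanishingIdeal (⟨{x}, hxcl⟩ : Closeds ↥(vanishingIdeal (⟨closure T, isClosed_closure⟩ : Closeds F)).subscheme) ≠ ⊥ := by
      intro h
      have hs := congrArg (fun I : ((vanishingIdeal (⟨closure T, isClosed_closure⟩ : Closeds F)).subscheme).IdealSheafData =>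
        (I.support : Set ↥(vanishingIdeal (⟨closure T, isClosed_closure⟩ : Closeds F)).subscheme)) h
      simp only [Scheme.IdealSheafData.coe_support_vanishingIdeal, Scheme.IdealSheafData.support_bot] at hs
      have hmem : ξ' ∈ (((⊤ : Closeds ↥(vanishingIdeal (⟨closure T, isClosed_closure⟩ : Closeds F)).subscheme)) :
          Set ↥(vanishingIdeal (⟨closure T, isClosed_closure⟩ : Closeds F)).subscheme) := trivial
      rw [← hs] at hmem
      exact hξ'x (Set.mem_singleton_iff.mp hmem)
    haveI hΓ₂int : IsIntegral (vanishingIdeal C₂).subscheme := hρbl.isIntegral h𝔪ne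
    -- the opens off `x` (in `Γ`) and off `ι x` (in `F`), over which `ρ` and the ambient blow-up are isomorphisms
    obtain ⟨UΓ, hUΓ⟩ : ∃ UΓ : ((vanishingIdeal (⟨closure T, isClosed_closure⟩ : Closeds F)).subscheme).Opens,
        (UΓ : Set _) = {x}ᶜ := ⟨⟨{x}ᶜ, hxcl.isOpen_compl⟩, rfl⟩
    have hmemUΓ : ∀ y, y ∈ UΓ ↔ y ≠ x := fun y => by change y ∈ (UΓ : Set _) ↔ _; rw [hUΓ]; rfl
    haveI : IsIso (ρ ∣_ UΓ) := hρbl.isIso_morphismRestrict (by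
      rw [hUΓ, Scheme.IdealSheafData.coe_support_vanishingIdeal]; exact disjoint_compl_left)
    obtain ⟨UF, hUF⟩ : ∃ UF : F.Opens,
        (UF : Set F) = {((vanishingIdeal (⟨closure T, isClosed_closure⟩ : Closeds F)).subschemeι x : F)}ᶜ := ⟨⟨_, hx.isOpen_compl⟩, rfl⟩
    have hmemUF : ∀ w, w ∈ UF ↔ w ≠ ((vanishingIdeal (⟨closure T, isClosed_closure⟩ : Closeds F)).subschemeι x : F) :=
      fun w => by change w ∈ (UF : Set F) ↔ _; rw [hUF]; rfl
    haveI : IsIso ((blowup.π 𝔫) ∣_ UF) := hυ'.isIso_morphismRestrict (by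
      rw [hUF, Scheme.IdealSheafData.coe_support_vanishingIdeal]; exact disjoint_compl_left)
    -- the preimages of the remaining singular points
    have hpre : ∀ y : ↥(vanishingIdeal (⟨closure T, isClosed_closure⟩ : Closeds F)).subscheme, y ≠ x →
        ∃ z : ↥(vanishingIdeal C₂).subscheme, ρ z = y := fun y hy => exists_preimage_of_isIso_morphismRestrict ρ UΓ ((hmemUΓ y).mpr hy)
    choose σ hσ using hpre
    have huniq : ∀ (z : ↥(vanishingIdeal C₂).subscheme) (hz : ρ z ≠ x), z = σ (ρ z) hz := fun z hz =>
      eq_of_isIso_morphismRestrict ρ UΓ ((hmemUΓ _).mpr hz) (hσ _ hz).symm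
    let emb : {y // y ∈ S.erase x} → ↥(vanishingIdeal C₂).subscheme := fun y => σ y.1 (Finset.ne_of_mem_erase y.2)
    have hembρ : ∀ y : {y // y ∈ S.erase x}, ρ (emb y) = y.1 := fun y => hσ _ _
    have hembinj : Function.Injective emb := fun y₁ y₂ h => Subtype.ext (by rw [← hembρ y₁, ← hembρ y₂, h])
    let S₂ : Finset ↥(vanishingIdeal C₂).subscheme := (S.erase x).attach.image emb
    have hmemS₂ : ∀ z, z ∈ S₂ → ∃ y : {y // y ∈ S.erase x}, emb y = z := fun z hz => by
      obtain ⟨y, -, hy⟩ := Finset.mem_image.mp hz; exact ⟨y, hy⟩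
    have hnotS₂ : ∀ z, z ∉ S₂ → ρ z ≠ x → ρ z ∉ S := fun z hz hzx hρz =>
      hz (Finset.mem_image.mpr ⟨⟨ρ z, Finset.mem_erase.mpr ⟨hzx, hρz⟩⟩, Finset.mem_attach _ _, (huniq z hzx).symm⟩)
    -- closed points of `Γ₂` over closed points of `Γ` off `x`
    have hcl₂ : ∀ z : ↥(vanishingIdeal C₂).subscheme, ρ z ≠ x →
        IsClosed ({((vanishingIdeal (⟨closure T, isClosed_closure⟩ : Closeds F)).subschemeι (ρ z) : F)} : Set F) →
        IsClosed ({((vanishingIdeal C₂).subschemeι z : blowup 𝔫)} : Set (blowup 𝔫)) := by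
      intro z hzx hzcl
      have hzUF : (blowup.π 𝔫) ((vanishingIdeal C₂).subschemeι z) ∈ UF := by
        rw [hmemUF, ← hρι_apply]
        exact fun h => hzx (hιinj h)
      have e : ({((vanishingIdeal C₂).subschemeι z : blowup 𝔫)} : Set (blowup 𝔫)) =
          (blowup.π 𝔫) ⁻¹' {((vanishingIdeal (⟨closure T, isClosed_closure⟩ : Closeds F)).subschemeι (ρ z) : F)} := by
        ext w
        simp only [Set.mem_singleton_iff, Set.mem_preimage]
        exact ⟨fun h => by rw [h, ← hρι_apply], fun h => (eq_of_isIso_morphismRestrict (blowup.π 𝔫) UF hzUF (by rw [← hρι_apply, ← h])).symm⟩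
      rw [e]; exact hzcl.preimage (blowup.π 𝔫).continuous
    -- the point `ξ₂` over `ξ`
    have hξUF : ξ ∈ UF := (hmemUF ξ).mpr (fun h => hξS x hxS h.symm)
    obtain ⟨ξ₂, hξ₂⟩ := exists_preimage_of_isIso_morphismRestrict (blowup.π 𝔫) UF hξUF
    have hξT : ξ ∈ T := by rw [← hclT]; exact hξC
    have hξ₂C : ξ₂ ∈ (C₂ : Set (blowup 𝔫)) := by
      rw [hC₂set]; apply subset_closure
      exact ⟨show (blowup.π 𝔫) ξ₂ ∈ T by rw [hξ₂]; exact hξT, show (blowup.π 𝔫) ξ₂ ∉ _ by rw [hξ₂]; exact (hmemUF ξ).mp hξUF⟩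
    have hξ₂S : ∀ z ∈ S₂, ((vanishingIdeal C₂).subschemeι z : blowup 𝔫) ≠ ξ₂ := by
      intro z hz h
      obtain ⟨y, rfl⟩ := hmemS₂ z hz
      apply hξS y.1 (Finset.mem_of_mem_erase y.2)
      rw [← hξ₂, ← h, ← hρι_apply, hembρ]
    -- the next strict transform is closed irreducible, with reduced closure `Γ₂`
    have hT₂irr : IsIrreducible (closure ((blowup.π 𝔫) ⁻¹' (T \ {((vanishingIdeal (⟨closure T, isClosed_closure⟩ :
        Closeds F)).subschemeι x : F)}))) := by
      have hr : Set.range (vanishingIdeal C₂).subschemeι = closure ((blowup.π 𝔫) ⁻¹' (T \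
          {((vanishingIdeal (⟨closure T, isClosed_closure⟩ : Closeds F)).subschemeι x : F)})) := by
        rw [Scheme.IdealSheafData.range_subschemeι, Scheme.IdealSheafData.coe_support_vanishingIdeal, hC₂set]
      rw [← hr, ← Set.image_univ]
      exact (IrreducibleSpace.isIrreducible_univ _).image _ (Scheme.Hom.continuous _).continuousOn
    have hTC₂ : (⟨closure (closure ((blowup.π 𝔫) ⁻¹' (T \ {((vanishingIdeal (⟨closure T, isClosed_closure⟩ :
        Closeds F)).subschemeι x : F)}))), isClosed_closure⟩ : Closeds (blowup 𝔫)) = C₂ := Closeds.ext (by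
      change closure (closure _) = (C₂ : Set (blowup 𝔫))
      rw [closure_closure, hC₂set])
    -- the hypotheses of the induction at the next stage
    have hcard : S₂.card = N := by
      rw [Finset.card_image_of_injective _ hembinj, Finset.card_attach, Finset.card_erase_of_mem hxS, hS]
      rfl
    have hreg₂ : ∀ z : ↥(vanishingIdeal C₂).subscheme, z ∉ S₂ → IsRegularLocalRing (((vanishingIdeal C₂).subscheme).presheaf.stalk z) := by
      intro z hz
      by_cases hzx : ρ z = x
      · exact hone x hxS hxcl _ ρ hρbl z hzx
      · have hρzS : ρ z ∉ S := hnotS₂ z hz hzx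
        haveI : IsRegularLocalRing (((vanishingIdeal (⟨closure T, isClosed_closure⟩ : Closeds F)).subscheme).presheaf.stalk (ρ z)) :=
          hreg (ρ z) hρzS
        haveI := IsBlowup.isIso_stalkMap_of_not_mem_support hρbl (x' := z) (fun h => hzx (by
          have h' : ρ z ∈ ((vanishingIdeal (⟨{x}, hxcl⟩ : Closeds _)).support : Set _) := h
          rwa [Scheme.IdealSheafData.coe_support_vanishingIdeal] at h'))
        exact IsRegularLocalRing.of_ringEquiv
          (R := ((vanishingIdeal (⟨closure T, isClosed_closure⟩ : Closeds F)).subscheme).presheaf.stalk (ρ z))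
          (asIso (ρ.stalkMap z)).commRingCatIsoToRingEquiv
    have hcl₂' : ∀ z ∈ S₂, IsClosed ({((vanishingIdeal C₂).subschemeι z : blowup 𝔫)} : Set (blowup 𝔫)) := by
      intro z hz
      obtain ⟨y, rfl⟩ := hmemS₂ z hz
      have hyx : ρ (emb y) ≠ x := by rw [hembρ]; exact Finset.ne_of_mem_erase y.2
      refine hcl₂ (emb y) hyx ?_
      rw [hembρ]
      exact hcl y.1 (Finset.mem_of_mem_erase y.2)
    have hsing₂ : ∀ z ∈ S₂, ¬ IsRegularLocalRing (((vanishingIdeal C₂).subscheme).presheaf.stalk z) := by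
      intro z hz hzreg
      obtain ⟨y, rfl⟩ := hmemS₂ z hz
      have hyx : ρ (emb y) ≠ x := by rw [hembρ]; exact Finset.ne_of_mem_erase y.2
      apply hsing y.1 (Finset.mem_of_mem_erase y.2)
      haveI := hzreg
      haveI := IsBlowup.isIso_stalkMap_of_not_mem_support hρbl (x' := emb y) (fun h => hyx (by
        have h' : ρ (emb y) ∈ ((vanishingIdeal (⟨{x}, hxcl⟩ : Closeds _)).support : Set _) := h
        rwa [Scheme.IdealSheafData.coe_support_vanishingIdeal] at h'))
      rw [← hembρ y]
      exact IsRegularLocalRing.of_ringEquiv (R := ((vanishingIdeal C₂).subscheme).presheaf.stalk (emb y))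
        (asIso (ρ.stalkMap (emb y))).commRingCatIsoToRingEquiv.symm
    have hone₂ : ∀ z ∈ S₂, ∀ (hz : IsClosed ({z} : Set ↥(vanishingIdeal C₂).subscheme)) (Z : Scheme.{0})
        (τ : Z ⟶ (vanishingIdeal C₂).subscheme), IsBlowup τ (vanishingIdeal ⟨{z}, hz⟩) →
        ∀ w : Z, τ w = z → IsRegularLocalRing (Z.presheaf.stalk w) := by
      intro z hz hzcl Z τ hτ w hw
      obtain ⟨y, rfl⟩ := hmemS₂ z hz
      have hyS : y.1 ∈ S := Finset.mem_of_mem_erase y.2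
      have hyx : y.1 ≠ x := Finset.ne_of_mem_erase y.2
      have hycl : IsClosed ({y.1} : Set ↥(vanishingIdeal (⟨closure T, isClosed_closure⟩ : Closeds F)).subscheme) :=
        isClosed_singleton_of_injective _ hιinj (hcl y.1 hyS)
      exact oneStepAt_of_isIso_morphismRestrict ρ UΓ ((hmemUΓ _).mpr hyx) hycl (hone y.1 hyS hycl) (hembρ y) hzcl Z τ hτ w hw
    -- INDUCTION
    obtain ⟨F', ρ', T', hF', hreg'⟩ := ih (blowup 𝔫) (blowup.π 𝔫 ≫ ρF) _ isClosed_closure hT₂irr C₂ hTC₂ S₂ hcard ξ₂ hξ₂C hξ₂S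
      hreg₂ hcl₂' hsing₂ hone₂
    exact ⟨F', ρ', T', fun Q hstep hQ => hF' Q hstep (hstep F (blowup 𝔫) ρF T x (blowup.π 𝔫) hx hQ hxsing hυ'), hreg'⟩

end PointChain

end Summit.ResolutionOfSingularities.ResolutionOfSingularities.Cruxes.EquisingularLiftNat.Sections

end
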